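import Literature.NumberTheory.EllipticCurves.ShintaniLift
import HarnessLib

/-!
# Termwise integration of the Shintani kernel: `Φ_D(z) = √(Im z) ∑_k ∫_F φ(w) c_D(k) f_{w,Z}(ι♮ k) dμ(w)`

[[cite: Shintani1975, §2, (2.8)–(2.9), Prop. 2.1]] — first step of the unfolding of the theta
lift `Φ_D = ∫_F φ K_D` (`ShintaniLift`): the lattice sum in `K_D(w,z) = √(Im z) ∑_k c_D(k)
f_{w,Z}(ι♮ k)` is interchanged with the integral over the fundamental domain `F`.  We PROVE:

* `liftTerm D φ z k w = φ(w) c_D(k) f_{w,Z}(ι♮ k)` (`Z = z/(256D)`), `liftIntegrand_eq_tsum`;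
* `tsum_norm_cD_mul_le` — the pointwise majorant `∑_k ‖c_D(k) f_{aτ,Z}(ι♮k)‖ ≤ ‖j(a,τ)‖⁻² C (Im τ)²`
  (`ShintaniThetaSumBound` through `ShintaniLift.tsum_norm_shintaniFn_smul_le`);
* `lintegral_tsum_enorm_liftTerm_smul_fdo_lt_top`, `tsum_lintegral_enorm_liftTerm_ne_top` —
  **`∑_k ∫_F ‖term_k‖ < ∞`** (on each piece `g_q⁻¹𝒟ᵒ` the product of the decay of the translate of
  `φ` and the majorant is bounded, as in `ShintaniLift.integrableOn_liftIntegrand`);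
* **`shintaniLift_eq_tsum_integral`** — `Φ_D(z) = √(Im z) ∑_k ∫_F term_k` (Mathlib `integral_tsum`).

No named facts; the definitions are `zScaled` (an `abbrev`) and `liftTerm`.
-/

noncomputable section

open scoped MatrixGroups ModularForm Modular Topology ENNReal
open UpperHalfPlane hiding I
open Complex Filter MeasureTheory Set CongruenceSubgroup ModularGroup Real
open Literature.NumberTheory.EllipticCurves.ModularForms

namespace Literature.NumberTheory.EllipticCurves.Shintani

variable (D : ℕ) [NeZero D]

/-- The scaled variable `Z = z/(256 D)` of the kernel. [folklore] -/
abbrev zScaled (z : ℍ) : ℍ := mulPos (1 / (256 * D)) (scaleD_pos D) z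

/-- The `k`-th term of the lift's integrand: `φ(w) c_D(k) f_{w,Z}(ι♮ k)`. [folklore] -/
def liftTerm (φ : ℍ → ℂ) (z : ℍ) (k : Fin 3 → ℤ) (w : ℍ) : ℂ :=
  φ w * (cD D k * shintaniFn w (zScaled D z) (latSharp k))

/-- The kernel integrand is `√(Im z)` times the sum of the terms. [folklore] -/
theorem liftIntegrand_eq_tsum (φ : ℍ → ℂ) (z w : ℍ) :
    liftIntegrand D φ z w = (Real.sqrt z.im : ℂ) * ∑' k : Fin 3 → ℤ, liftTerm D φ z k w := by
  simp only [liftTerm]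
  rw [tsum_mul_left, liftIntegrand, kerD, genKernel]
  ring

/-- Each term is measurable in `w` (indeed continuous when `φ` is). [folklore] -/
theorem measurable_liftTerm {φ : ℍ → ℂ} (hφ : Measurable φ) (z : ℍ) (k : Fin 3 → ℤ) :
    Measurable (liftTerm D φ z k) :=
  hφ.mul ((continuous_const.mul (continuous_shintaniFn_left (zScaled D z) (latSharp k))).measurable)

/-- The pointwise bound for the sum of the norms of the terms on a translate:
`∑_k ‖c_D(k) f_{aτ,Z}(ι♮k)‖ ≤ ‖j(a,τ)‖⁻² C (Im τ)²` for `Im τ ≥ 1/2`. [folklore] -/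
theorem tsum_norm_cD_mul_le (a : SL(2, ℤ)) (z τ : ℍ) (hτ : 1 / 2 ≤ τ.im) :
    ∑' k : Fin 3 → ℤ, ‖cD D k * shintaniFn (a • τ) (zScaled D z) (latSharp k)‖ ≤
      (‖denom (a : GL (Fin 2) ℝ) τ‖ ^ 2)⁻¹ *
      (thetaZ (2 * ((2 * π * (zScaled D z).im) / 2) * (1 / 2) ^ 2) *
        thetaZ ((2 * π * (zScaled D z).im) / 2) *
        thetaZ (2 * ((2 * π * (zScaled D z).im) / 2) / (1 / 2) ^ 2) /
        ((1 / 2) * Real.sqrt (2 * (2 * π * (zScaled D z).im))) * τ.im ^ 2) := by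
  set Z : ℍ := zScaled D z with hZ
  have ha : 0 < 2 * π * Z.im := by have := Z.im_pos; positivity
  obtain ⟨hS, hB⟩ := tsum_norm_formEval_mul_exp_le ha (half_pos one_pos) τ hτ
  have hs1 : Summable fun k : Fin 3 → ℤ ↦ ‖shintaniFn (a • τ) Z (latSharp k)‖ := by
    have := summable_term (c := fun _ ↦ (1 : ℂ)) ⟨1, fun _ ↦ by simp⟩ (a • τ) Z
    simpa using this.norm
  calc ∑' k : Fin 3 → ℤ, ‖cD D k * shintaniFn (a • τ) Z (latSharp k)‖
      ≤ ∑' k : Fin 3 → ℤ, ‖shintaniFn (a • τ) Z (latSharp k)‖ := by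
        refine Summable.tsum_le_tsum (fun k ↦ ?_) ((summable_term (bddWeight_cD D) (a • τ) Z).norm) hs1
        rw [norm_mul]
        exact mul_le_of_le_one_left (norm_nonneg _) (norm_cD_le_one D k)
    _ ≤ _ := tsum_norm_shintaniFn_smul_le a τ Z
    _ ≤ _ := mul_le_mul_of_nonneg_left hB (by positivity)

/-- **Finiteness of `∑_k ∫ ‖term_k‖` on a translate of `𝒟ᵒ`.** [cite: Shintani1975, §2, Prop. 2.1] -/
theorem lintegral_tsum_enorm_liftTerm_smul_fdo_lt_top (f : CuspForm (Gamma0 64) 2) (z : ℍ) (s : SL(2, ℤ)) :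
    ∫⁻ τ in {τ : ℍ | s • τ ∈ 𝒟ᵒ}, ∑' k : Fin 3 → ℤ, ‖liftTerm D f z k τ‖ₑ < ∞ := by
  set sG : GL (Fin 2) ℝ := (s : GL (Fin 2) ℝ) with hsG
  have hmp : MeasurePreserving (fun τ : ℍ ↦ sG • τ) volume volume := measurePreserving_smul _ _
  have hme : MeasurableEmbedding (fun τ : ℍ ↦ sG • τ) :=
    (MeasurableEquiv.smul sG).measurableEmbedding
  have hset : {τ : ℍ | s • τ ∈ 𝒟ᵒ} = (fun τ : ℍ ↦ sG • τ) ⁻¹' 𝒟ᵒ := by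
    ext τ; simp [hsG]
  set G : ℍ → ℝ≥0∞ := fun τ ↦ ∑' k : Fin 3 → ℤ, ‖liftTerm D f z k τ‖ₑ with hGdef
  change ∫⁻ τ in {τ : ℍ | s • τ ∈ 𝒟ᵒ}, G τ < ∞
  have h2 : ∫⁻ τ in (fun τ : ℍ ↦ sG • τ) ⁻¹' 𝒟ᵒ, G τ = ∫⁻ σ in 𝒟ᵒ, G (sG⁻¹ • σ) := by
    have := hmp.setLIntegral_comp_preimage_emb hme (fun σ ↦ G (sG⁻¹ • σ)) 𝒟ᵒ
    simp only [inv_smul_smul] at this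
    exact this
  rw [hset, h2]
  set a : SL(2, ℤ) := s⁻¹ with ha
  have haG : ∀ σ : ℍ, sG⁻¹ • σ = a • σ := by
    intro σ
    simp [ha, hsG, ModularGroup.sl_moeb, map_inv]
  simp_rw [haG]
  -- bounds
  obtain ⟨B, c, hc, hB0, hB⟩ := exists_decay_translate f a
  set Cz : ℝ := thetaZ (2 * ((2 * π * (zScaled D z).im) / 2) * (1 / 2) ^ 2) *
      thetaZ ((2 * π * (zScaled D z).im) / 2) *
      thetaZ (2 * ((2 * π * (zScaled D z).im) / 2) / (1 / 2) ^ 2) /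
      ((1 / 2) * Real.sqrt (2 * (2 * π * (zScaled D z).im))) with hCz
  have hCz0 : 0 ≤ Cz := by
    rw [hCz]
    have := (zScaled D z).im_pos
    refine div_nonneg (mul_nonneg (mul_nonneg (thetaZ_nonneg _) (thetaZ_nonneg _)) (thetaZ_nonneg _)) ?_
    positivity
  set M : ℝ := B * Cz * (4 / c ^ 2) with hM
  -- pointwise bound on `𝒟ᵒ`
  have hpt : ∀ σ ∈ 𝒟ᵒ, G (a • σ) ≤ ENNReal.ofReal M := by
    intro σ hσ
    have hσ2 : 1 / 2 ≤ σ.im :=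
      ((mem_verticalStrip_iff _ _ _).mp (fd_subset_verticalStrip (ModularGroup.fdo_subset_fd hσ))).2
    have hd0 : denom (a : GL (Fin 2) ℝ) σ ≠ 0 := denom_ne_zero _ _
    have hdn : 0 < ‖denom (a : GL (Fin 2) ℝ) σ‖ := norm_pos_iff.mpr hd0
    have h1 := hB σ hσ2
    have h2 := tsum_norm_cD_mul_le D a z σ hσ2
    rw [← hCz] at h2
    have h3 := sq_mul_exp_neg_le hc σ.im_pos.le
    have hsum : Summable fun k : Fin 3 → ℤ ↦ ‖cD D k * shintaniFn (a • σ) (zScaled D z) (latSharp k)‖ :=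
      (summable_term (bddWeight_cD D) (a • σ) (zScaled D z)).norm
    -- `G(aσ) = ofReal (‖f(aσ)‖ Σ_k ‖c_D f‖)`
    have hG : G (a • σ) = ENNReal.ofReal (‖f (a • σ)‖ *
        ∑' k : Fin 3 → ℤ, ‖cD D k * shintaniFn (a • σ) (zScaled D z) (latSharp k)‖) := by
      rw [hGdef]
      simp only [liftTerm]
      rw [← tsum_mul_left, ENNReal.ofReal_tsum_of_nonneg (fun k ↦ by positivity) (hsum.mul_left _)]
      refine tsum_congr fun k ↦ ?_
      rw [← norm_mul, ofReal_norm]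
    rw [hG]
    refine ENNReal.ofReal_le_ofReal ?_
    calc ‖f (a • σ)‖ * ∑' k : Fin 3 → ℤ, ‖cD D k * shintaniFn (a • σ) (zScaled D z) (latSharp k)‖
        ≤ (B * ‖denom (a : GL (Fin 2) ℝ) σ‖ ^ 2 * Real.exp (-c * σ.im)) *
          ((‖denom (a : GL (Fin 2) ℝ) σ‖ ^ 2)⁻¹ * (Cz * σ.im ^ 2)) :=
          mul_le_mul h1 h2 (tsum_nonneg fun _ ↦ norm_nonneg _) (by positivity)
      _ = B * Cz * (σ.im ^ 2 * Real.exp (-c * σ.im)) := by field_simp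
      _ ≤ B * Cz * (4 / c ^ 2) := by gcongr
      _ = M := by rw [hM]
  calc ∫⁻ σ in 𝒟ᵒ, G (a • σ) ≤ ∫⁻ _ in 𝒟ᵒ, ENNReal.ofReal M :=
        setLIntegral_mono measurable_const hpt
    _ = ENNReal.ofReal M * volume 𝒟ᵒ := setLIntegral_const _ _
    _ < ∞ := by
        refine ENNReal.mul_lt_top ENNReal.ofReal_lt_top ?_
        exact (measure_mono ModularGroup.fdo_subset_fd).trans_lt volume_fd_lt_top

/-- **Finiteness of `∑_k ∫_F ‖term_k‖`** on the whole domain `F`. [cite: Shintani1975, §2, Prop. 2.1] -/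
theorem tsum_lintegral_enorm_liftTerm_ne_top (f : CuspForm (Gamma0 64) 2) (z : ℍ) :
    ∑' k : Fin 3 → ℤ, ∫⁻ w in liftDomain, ‖liftTerm D f z k w‖ₑ ≠ ∞ := by
  haveI := Fintype.ofFinite (↥𝒮ℒ ⧸ (Gamma0 64 : Subgroup (GL (Fin 2) ℝ)).subgroupOf 𝒮ℒ)
  have hmeas : ∀ k, Measurable (liftTerm D f z k) :=
    fun k ↦ measurable_liftTerm D (CuspFormClass.holo f).continuous.measurable z k
  rw [← lintegral_tsum fun k ↦ (hmeas k).enorm.aemeasurable]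
  refine ne_of_lt ?_
  unfold liftDomain
  calc ∫⁻ w in ⋃ q, {τ : ℍ | reps q • τ ∈ 𝒟ᵒ}, ∑' k, ‖liftTerm D f z k w‖ₑ
      ≤ ∑ q, ∫⁻ w in {τ : ℍ | reps q • τ ∈ 𝒟ᵒ}, ∑' k, ‖liftTerm D f z k w‖ₑ := by
        refine (lintegral_iUnion_le _ _).trans ?_
        rw [tsum_fintype]
    _ < ∞ := by
        refine ENNReal.sum_lt_top.mpr fun q _ ↦ ?_
        exact lintegral_tsum_enorm_liftTerm_smul_fdo_lt_top D f z (reps q)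

/-- **Termwise integration**: `Φ_D(z) = √(Im z) ∑_k ∫_F φ(w) c_D(k) f_{w,Z}(ι♮ k) dμ(w)` — the
interchange of the lattice sum and the integral over the fundamental domain, justified by the
absolute convergence of `∑_k ∫_F ‖·‖`. [cite: Shintani1975, §2, (2.8)–(2.9)] -/
theorem shintaniLift_eq_tsum_integral (f : CuspForm (Gamma0 64) 2) (z : ℍ) :
    shintaniLift D f z = (Real.sqrt z.im : ℂ) * ∑' k : Fin 3 → ℤ, ∫ w in liftDomain, liftTerm D f z k w := by
  have hmeas : ∀ k, Measurable (liftTerm D f z k) :=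
    fun k ↦ measurable_liftTerm D (CuspFormClass.holo f).continuous.measurable z k
  rw [shintaniLift_eq]
  simp_rw [liftIntegrand_eq_tsum]
  rw [integral_const_mul, integral_tsum (fun k ↦ (hmeas k).aestronglyMeasurable)
    (tsum_lintegral_enorm_liftTerm_ne_top D f z)]

end Literature.NumberTheory.EllipticCurves.Shintani
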